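import Summits.QuantumFields.YangMills.Theorems.IR.ShellMaxCorrStrongCouplingClustering
import Summits.QuantumFields.YangMills.Theorems.ConvexGribovBodyContinuumLegGivenGapStubObsGeometry
import Summits.QuantumFields.YangMills.Theorems.HyperbolicRegulatorHyperbolicToTorusRDefs
import Summits.QuantumFields.YangMills.Theorems.BalabanLadderNTPointwiseFloor
import Summits.QuantumFields.YangMills.Theorems.FixedTorusFirstFunctionalRungEnvelope
import HarnessLib

/-!
# `FixedTorusFirst.FiniteSizeInsensitivity` (item stmt-QuantumFields-27355) — BC5 witness #3:
# the `S`-side analogue is FALSE on the witness window (no two-point floors at strong coupling)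

Helper module for the crux `FiniteSizeInsensitivity` of route `FixedTorusFirst`
(`--supports stmt-QuantumFields-27355`; it closes nothing).  The landed witnesses
`rung_strongCouplingFiniteSize` / `rung_functional_strongCoupling` show the crux's clauses HOLD on
the strong-coupling window `|β| ≤ β₀` uniformly in the unit.  This file shows that on the same
window the statement the crux SERVES — the reflection floor of `BalabanLadder.NT` /
`SomeTorusFloors` (`LowerBounds` (i): `ε ≤ Q2_{β,L,s}(θv, v)` on all large tori) — FAILS as the
unit is refined:
* `Q2_theta_abs_le_strongCoupling` — for every compact `G` and lattice representation `r` there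
  is `β₀ > 0` such that for every compactly supported Schwartz `v` with `tsupport v ⊆ {y₀ > 0}` and
  every `η > 0` there are `s₁ > 0`, `Λ` with `|Q2_{β,L,s}(θv, v)| ≤ η` for all `|β| ≤ β₀`, all
  units `0 < s ≤ s₁` and all tori with `s·L ≥ Λ`;
* `no_twoPointFloor_strongCoupling(_borel)` — hence at a fixed strong coupling NO positive-time
  compactly supported witness has a floor `ε > 0` persisting to arbitrarily fine units on large
  tori.  So on the witness regime `C` is decided TRUE and the `S`-type floor FALSE.

Mechanism (all inputs in the tree): a charged pair `θv(s x) ≠ 0`, `v(s y) ≠ 0` is separated by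
`n = y₀ − x₀ ≥ 2δ/s` lattice units of time (`two_mul_timeGap_le_of_charged`); by torus translation
invariance (`obsGeometry_integral_torusLift_configShift`) `Cov_L(dens x, dens y)` is the connected
time correlation at separation `n` of the curvature species and its purely SPATIAL translate
(`shiftObs`), whose time-translates live outside the sup-ball of radius `n − r_B` with `r_B`
INDEPENDENT of the spatial offset (`dependsOn_outBall_of_timeBound`); the strong-coupling shell
certificate `ShellMaxCorr.stub_shellRung` and the doubling engine
`ShellMaxCorr.abs_latticeConnectedCorr_le_exp_of_shellCert` give `|Cov| ≤ K e^{−(log 2/6) n}` with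
ONE constant `K`, uniformly in the torus; the `(2⌊R/s⌋+1)⁸` pairs cost a polynomial in `1/s`,
absorbed by `e^{−(log 2/3) δ/s}` (`noFloors_envelope`).

Lattice strong coupling only: nothing is asserted about `β → ∞`, the continuum limit, the mass
gap, `SomeTorusFloors`, `NT` or the summit.  References: K. Osterwalder, E. Seiler, Ann. Phys. 110
(1978) 440, Thm 3.5 [cite: OsterwalderSeiler1978, Thm 3.5]; I. Montvay, G. Münster, *Quantum
Fields on a Lattice* (1994) §3.4 [cite: MontvayMunster1994, §3.4].
-/

set_option autoImplicit false

noncomputable section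

open scoped SchwartzMap
open MeasureTheory Filter
open Literature.MathematicalPhysics.QuantumFieldTheory Literature.MathematicalPhysics.QuantumLattice
open Literature.Probability.LatticeModels (Torus.proj box mem_box card_box)
open Summit.QuantumFields.YangMills.Cruxes.OSLegsFromFemtoAndGap.DlrCollarTransfer (dens torusE Q2)
open Summit.QuantumFields.YangMills.Cruxes.IR.ShellMaxCorr (siteNorm OutBall ShellCert
  stub_shellRung abs_latticeConnectedCorr_le_exp_of_shellCert exists_radius_dependsOn_inBall
  natAbs_valMinAbs_apply_le_siteNorm sub_natAbs_le_natAbs_valMinAbs siteNorm_le_shift)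
open Summit.QuantumFields.YangMills.Theorems.ContinuumLegGivenGap
  (obsGeometry_integral_torusLift_configShift obsGeometry_configShift_add)
open Summit.QuantumFields.YangMills.Cruxes.HyperbolicToTorusR.ReplicaRooting (shiftObs)
open Summit.QuantumFields.YangMills.Cruxes.NT.PointwiseFloor (two_mul_timeGap_le_of_charged)
open Summit.QuantumFields.YangMills.Cruxes.NT.Reference (exists_timeGap_of_tsupport_subset)

namespace Summit.QuantumFields.YangMills.Cruxes.FiniteSizeInsensitivity.Rung

/-! ## §1 Outer support of a time-thin observable, uniformly in its spatial extent -/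

section Support

variable {G : Type} [Group G] [MeasurableSpace G]

/-- **Outer support from the TIME extent only.**  If every link of the support of `B` has time
coordinate `|x₀| ≤ M`, then on the torus of side `2S+1` the time-translate of `B` by `n ≤ S` read
through the periodic lift depends only on links outside the open sup-ball of radius `n − (M+1)` —
whatever the spatial extent of the support (sharpening `exists_radius_dependsOn_outBall`, whose
radius is the full sup-norm radius of the support). -/
theorem dependsOn_outBall_of_timeBound (B : LocalGaugeObservable 4 G) (M : ℕ)
    (hM : ∀ e ∈ B.supp, (e.1 0).natAbs ≤ M) (S n : ℕ) (hn : n ≤ S) :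
    DependsOn (fun U : GaugeConfig 4 (2 * S + 1) G =>
      B.F (configShift (-Pi.single 0 (n : ℤ)) (torusLift (2 * S + 1) U)))
      {e | OutBall (n - (M + 1)) e} := by
  classical
  intro U V hUV
  apply B.isCylinder
  intro e he
  rw [configShift_apply, configShift_apply]
  refine hUV (torusEdge (2 * S + 1) (e.1 - -Pi.single 0 (n : ℤ), e.2)) ?_
  simp only [torusEdge, Set.mem_setOf_eq, sub_neg_eq_add]
  have hx0 : (e.1 0).natAbs ≤ M := hM e he
  set y : Site 4 (2 * S + 1) := Torus.proj (2 * S + 1) (e.1 + Pi.single 0 (n : ℤ)) with hy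
  have hbase : n - M ≤ siteNorm y := by
    refine le_trans ?_ (natAbs_valMinAbs_apply_le_siteNorm y 0)
    have h := sub_natAbs_le_natAbs_valMinAbs S n hn (e.1 0)
    have hy0 : y 0 = (((e.1 0 + n : ℤ) : ℤ) : ZMod (2 * S + 1)) := by
      simp only [hy, Torus.proj, Pi.add_apply, Pi.single_eq_same]
    rw [hy0]
    exact le_trans (Nat.sub_le_sub_left hx0 n) h
  have htip : n - (M + 1) ≤ siteNorm (y.shift e.2) := by
    have := siteNorm_le_shift y e.2
    omega
  exact ⟨le_trans (Nat.sub_le_sub_left (Nat.le_succ M) n) hbase, htip⟩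

end Support

/-! ## §2 Density covariances at strong coupling: one constant for all pairs and all tori -/

section Clustering

variable {G : Type} [Group G] [TopologicalSpace G] [IsTopologicalGroup G] [CompactSpace G]
  [MeasurableSpace G] [BorelSpace G] (r : LatticeRep G)

/-- **Recentring.**  By torus translation invariance the covariance of the action densities at
`x` and `y = x + w + n e₀` is the connected time correlation at separation `n` of the curvature
species and its spatial translate `B_w = A ∘ θ_{−w}`. -/
theorem cov_dens_eq_corr (β : ℝ) (L : ℕ) (x y w : Fin 4 → ℤ) (n : ℕ)
    (hxy : y = x + (w + Pi.single 0 (n : ℤ))) :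
    torusE G r β L (fun U => dens G r x U * dens G r y U) -
        torusE G r β L (dens G r x) * torusE G r β L (dens G r y) =
      latticeConnectedCorr r.ρ β (2 * L + 1) r.curvature.F (shiftObs r.curvature (-w)).F n := by
  have hyx : ∀ V : LGConfig 4 G, configShift (-y) V =
      configShift (-w) (configShift (-Pi.single 0 (n : ℤ)) (configShift (-x) V)) := by
    intro V
    rw [← obsGeometry_configShift_add, ← obsGeometry_configShift_add, hxy]
    congr 1
    abel
  simp only [torusE, dens, latticeConnectedCorr, shiftObs]
  rw [obsGeometry_integral_torusLift_configShift r.ρ β (-x) r.curvature.F,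
    obsGeometry_integral_torusLift_configShift r.ρ β (-y) r.curvature.F,
    obsGeometry_integral_torusLift_configShift r.ρ β (-w) r.curvature.F]
  congr 1
  simp_rw [hyx]
  exact obsGeometry_integral_torusLift_configShift r.ρ β (-x)
    (fun V => r.curvature.F V *
      r.curvature.F (configShift (-w) (configShift (-Pi.single 0 (n : ℤ)) V)))

/-- **Uniform strong-coupling clustering of density covariances.**  There are `β₀ > 0` and ONE
constant `K` such that for all `|β| ≤ β₀`, all tori `(2L+1)⁴` and all pairs of sites with time
separation `n = y₀ − x₀ ≤ L` (any spatial offset),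
`|Cov_L(dens x, dens y)| ≤ K e^{−(log 2/6) n}`. -/
theorem abs_cov_dens_le_exp [T2Space G] [SecondCountableTopology G] :
    ∃ β₀ : ℝ, 0 < β₀ ∧ ∃ K : ℝ, 0 ≤ K ∧ ∀ β : ℝ, |β| ≤ β₀ →
      ∀ (L : ℕ) (x y : Fin 4 → ℤ) (n : ℕ), (n : ℤ) = y 0 - x 0 → n ≤ L →
        |torusE G r β L (fun U => dens G r x U * dens G r y U) -
            torusE G r β L (dens G r x) * torusE G r β L (dens G r y)| ≤
          K * Real.exp (-(Real.log 2 / 6 * n)) := by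
  classical
  obtain ⟨β₀, hβ₀, hR⟩ := stub_shellRung G r.N r.ρ r.continuous
  obtain ⟨rA, hA⟩ := exists_radius_dependsOn_inBall r.curvature
  obtain ⟨C, hC⟩ := r.curvature.bounded
  set Mc : ℕ := r.curvature.supp.sup fun e => (e.1 0).natAbs with hMc
  have hC0 : 0 ≤ C := (abs_nonneg _).trans (hC fun _ => 1)
  refine ⟨β₀, hβ₀, 2 * C * C * Real.exp (Real.log 2 / 6 * ((rA : ℝ) + ((Mc + 1 : ℕ) : ℝ) + 2)),
    by positivity, fun β hβ L x y n hn hnL => ?_⟩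
  set w : Fin 4 → ℤ := y - x - Pi.single 0 (n : ℤ) with hw
  have hxy : y = x + (w + Pi.single 0 (n : ℤ)) := by rw [hw]; abel
  have hw0 : w 0 = 0 := by
    simp only [hw, Pi.sub_apply, Pi.single_eq_same]
    omega
  have hBM : ∀ e ∈ (shiftObs r.curvature (-w)).supp, (e.1 0).natAbs ≤ Mc := by
    intro e he
    simp only [shiftObs, Finset.mem_image] at he
    obtain ⟨e', he', rfl⟩ := he
    have h0 : (e'.1 - -w) 0 = e'.1 0 := by simp [hw0]
    show ((e'.1 - -w) 0).natAbs ≤ Mc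
    rw [h0]
    exact Finset.le_sup
      (f := fun e : Literature.MathematicalPhysics.QuantumLattice.ZdEdge 4 => (e.1 0).natAbs) he'
  have hB := dependsOn_outBall_of_timeBound (shiftObs r.curvature (-w)) Mc hBM
  have hceil : ⌈(1 : ℝ) / 1⌉₊ = 1 := by norm_num
  have hcert : ShellCert r.ρ β L ⌈(1 : ℝ) / 1⌉₊ (1 / 2) := by
    rw [hceil]; exact fun R => hR β hβ L R
  have key := abs_latticeConnectedCorr_le_exp_of_shellCert r.ρ r.continuous (K₀ := 1)
    (θ₁ := 1 / 2) (ab := 1) one_pos one_half_pos one_half_lt_one one_pos le_rfl β L hcert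
    r.curvature (shiftObs r.curvature (-w)) hA hB hC (fun U => hC _) hnL
  have hrate : -Real.log (1 / 2) / (6 * 1) * 1 = Real.log 2 / 6 := by
    rw [one_div, Real.log_inv]; ring
  rw [hrate, ← cov_dens_eq_corr r β L x y w n hxy] at key
  exact key

end Clustering

/-! ## §3 The envelope: a polynomial number of pairs against exponential decay in `1/s` -/

/-- `(2N+1)⁸ · A e^{−2κ/s} ≤ η` once `N ≤ R/s`, `s ≤ 1` and `s ≤ ηκ / (A (2R+1)⁸ (8/κ)⁸ + 1)`. -/
theorem noFloors_envelope {A κ s R η : ℝ} (hA : 0 ≤ A) (hκ : 0 < κ) (hs : 0 < s) (hs1 : s ≤ 1)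
    (hR : 0 < R) (hη : 0 < η) {N : ℕ} (hN : (N : ℝ) ≤ R / s)
    (hsη : s ≤ η * κ / (A * (2 * R + 1) ^ 8 * (8 / κ) ^ 8 + 1)) :
    (((2 * N + 1) ^ 4 : ℕ) : ℝ) * ((((2 * N + 1) ^ 4 : ℕ) : ℝ) *
      (A * Real.exp (-(κ * (2 / s))))) ≤ η := by
  set Q : ℝ := A * (2 * R + 1) ^ 8 * (8 / κ) ^ 8 with hQ
  have hQ0 : 0 ≤ Q := by positivity
  have hQ1 : (0 : ℝ) < Q + 1 := by positivity
  have hu1 : 1 ≤ 1 / s := by rw [le_div_iff₀ hs]; linarith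
  have hu0 : (0 : ℝ) ≤ 1 / s := by positivity
  have hN1 : (2 * N + 1 : ℝ) ≤ (2 * R + 1) * (1 / s) := by
    have : (N : ℝ) ≤ R * (1 / s) := by rwa [← div_eq_mul_one_div]
    nlinarith
  have h8 : (2 * N + 1 : ℝ) ^ 8 ≤ (2 * R + 1) ^ 8 * (1 / s) ^ 8 := by
    rw [← mul_pow]; exact pow_le_pow_left₀ (by positivity) hN1 8
  have hpe : (1 / s) ^ 8 ≤ (8 / κ) ^ 8 * Real.exp (κ * (1 / s)) := by
    have h := pow_le_mul_exp (n := 8) (by norm_num) hκ hu0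
    norm_num at h ⊢
    exact h
  have hexp : Real.exp (κ * (1 / s)) * Real.exp (-(κ * (2 / s))) =
      Real.exp (-(κ * (1 / s))) := by
    rw [← Real.exp_add]; congr 1; ring
  have hinv : Real.exp (-(κ * (1 / s))) ≤ s / κ := by
    have h1 : κ * (1 / s) ≤ Real.exp (κ * (1 / s)) := by
      linarith [Real.add_one_le_exp (κ * (1 / s))]
    have h2 : 0 < κ * (1 / s) := by positivity
    rw [Real.exp_neg]
    calc (Real.exp (κ * (1 / s)))⁻¹ ≤ (κ * (1 / s))⁻¹ := inv_anti₀ h2 h1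
      _ = s / κ := by field_simp
  have hcast : (((2 * N + 1) ^ 4 : ℕ) : ℝ) = (2 * N + 1 : ℝ) ^ 4 := by push_cast; ring
  rw [hcast]
  calc (2 * N + 1 : ℝ) ^ 4 * ((2 * N + 1 : ℝ) ^ 4 * (A * Real.exp (-(κ * (2 / s)))))
      = (2 * N + 1 : ℝ) ^ 8 * (A * Real.exp (-(κ * (2 / s)))) := by ring
    _ ≤ (2 * R + 1) ^ 8 * (1 / s) ^ 8 * (A * Real.exp (-(κ * (2 / s)))) :=
        mul_le_mul_of_nonneg_right h8 (by positivity)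
    _ ≤ (2 * R + 1) ^ 8 * ((8 / κ) ^ 8 * Real.exp (κ * (1 / s))) *
          (A * Real.exp (-(κ * (2 / s)))) :=
        mul_le_mul_of_nonneg_right (mul_le_mul_of_nonneg_left hpe (by positivity))
          (by positivity)
    _ = Q * (Real.exp (κ * (1 / s)) * Real.exp (-(κ * (2 / s)))) := by rw [hQ]; ring
    _ = Q * Real.exp (-(κ * (1 / s))) := by rw [hexp]
    _ ≤ Q * (s / κ) := mul_le_mul_of_nonneg_left hinv hQ0
    _ ≤ Q * (η * κ / (Q + 1) / κ) :=
        mul_le_mul_of_nonneg_left (div_le_div_of_nonneg_right hsη hκ.le) hQ0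
    _ = η * (Q / (Q + 1)) := by field_simp
    _ ≤ η * 1 := by
        refine mul_le_mul_of_nonneg_left ?_ hη.le
        rw [div_le_one hQ1]; linarith
    _ = η := mul_one η

/-! ## §4 No two-point floors at strong coupling -/

section NoFloors

variable {G : Type} [Group G] [TopologicalSpace G] [IsTopologicalGroup G] [CompactSpace G]
  [MeasurableSpace G] [BorelSpace G] (r : LatticeRep G)

/-- **`Q2(θv, v) → 0` as the unit is refined, at strong coupling, uniformly in the torus.**  For
every compact `G` and lattice representation `r` there is `β₀ > 0` such that for every compactly
supported Schwartz `v` supported at positive times and every `η > 0` there are `s₁ > 0` and `Λ` with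
`|Q2_{β,L,s}(θv, v)| ≤ η` for all `|β| ≤ β₀`, all `0 < s ≤ s₁` and all `L` with `Λ ≤ s·L`. -/
theorem Q2_theta_abs_le_strongCoupling :
    ∃ β₀ : ℝ, 0 < β₀ ∧ ∀ v : 𝓢(EuclideanSpace ℝ (Fin 4), ℝ),
      tsupport (v : EuclideanSpace ℝ (Fin 4) → ℝ) ⊆ {y | 0 < y 0} →
      HasCompactSupport (v : EuclideanSpace ℝ (Fin 4) → ℝ) →
      ∀ η : ℝ, 0 < η → ∃ s₁ : ℝ, 0 < s₁ ∧ ∃ Λ : ℝ, ∀ β : ℝ, |β| ≤ β₀ →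
        ∀ s : ℝ, 0 < s → s ≤ s₁ → ∀ L : ℕ, Λ ≤ s * L →
          |Q2 G r β L s (thetaTest 4 v) v| ≤ η := by
  classical
  haveI : T2Space G := (r.continuous.isClosedEmbedding r.injective).isEmbedding.t2Space
  haveI : SecondCountableTopology G :=
    (r.continuous.isClosedEmbedding r.injective).isEmbedding.secondCountableTopology
  obtain ⟨β₀, hβ₀, K, hK0, hcl⟩ := abs_cov_dens_le_exp r
  have hlog2 : 0 < Real.log 2 := Real.log_pos (by norm_num)
  refine ⟨β₀, hβ₀, fun v hv hvc η hη => ?_⟩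
  obtain ⟨M, R, hM0, hR0, hMv, hRv⟩ := exists_bound_and_radius v hvc
  -- the time gap of `v`
  obtain ⟨σ, hσ⟩ := hvc.isCompact.isBounded.subset_closedBall (0 : EuclideanSpace ℝ (Fin 4))
  obtain ⟨δ, hδ, hvδ⟩ := exists_timeGap_of_tsupport_subset hv hσ
  -- constants
  set κ : ℝ := Real.log 2 / 6 * δ with hκ
  have hκ0 : 0 < κ := by positivity
  set A : ℝ := M * M * K with hA
  have hA0 : 0 ≤ A := by positivity
  have hden : (0 : ℝ) < A * (2 * R + 1) ^ 8 * (8 / κ) ^ 8 + 1 := by positivity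
  refine ⟨min 1 (η * κ / (A * (2 * R + 1) ^ 8 * (8 / κ) ^ 8 + 1)),
    lt_min one_pos (by positivity), 2 * R, fun β hβ s hs hs1 L hL => ?_⟩
  have hs_one : s ≤ 1 := hs1.trans (min_le_left _ _)
  have hsη : s ≤ η * κ / (A * (2 * R + 1) ^ 8 * (8 / κ) ^ 8 + 1) := hs1.trans (min_le_right _ _)
  -- the box carrying the test functions
  set N : ℕ := ⌊R / s⌋₊ with hN
  have hRs : R / s < (N : ℝ) + 1 := Nat.lt_floor_add_one _
  have hNle : (N : ℝ) ≤ R / s := Nat.floor_le (by positivity)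
  have h2N : 2 * N ≤ L := by
    have h1 : 2 * R / s ≤ L := by rw [div_le_iff₀ hs]; linarith
    have h2 : (2 * N : ℝ) ≤ L := by
      have : (2 : ℝ) * N ≤ 2 * R / s := by rw [mul_div_assoc]; linarith
      linarith
    exact_mod_cast h2
  have hNL : N ≤ L := by omega
  have hRθ : ∀ p : EuclideanSpace ℝ (Fin 4), R ≤ ‖p‖ → thetaTest 4 v p = 0 := by
    intro p hp
    rw [thetaTest_apply]
    exact hRv _ (by rwa [LinearIsometryEquiv.norm_map])
  have hvf : ∀ x : Fin 4 → ℤ, x ∉ box 4 N → thetaTest 4 v (s • siteToE x) = 0 :=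
    fun x hx => test_vanish hRθ le_rfl hs hRs hx
  have hvg : ∀ y : Fin 4 → ℤ, y ∉ box 4 N → v (s • siteToE y) = 0 :=
    fun y hy => test_vanish hRv le_rfl hs hRs hy
  have hMθ : ∀ p : EuclideanSpace ℝ (Fin 4), |thetaTest 4 v p| ≤ M := fun p => by
    rw [thetaTest_apply]; exact hMv _
  -- each charged pair is time-separated by `n ≥ 2δ/s` lattice units and clusters
  have hterm : ∀ x ∈ box 4 N, ∀ y ∈ box 4 N,
      |thetaTest 4 v (s • siteToE x) * v (s • siteToE y) *
          (torusE G r β L (fun U => dens G r x U * dens G r y U) -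
            torusE G r β L (dens G r x) * torusE G r β L (dens G r y))| ≤
        A * Real.exp (-(κ * (2 / s))) := by
    intro x hx y hy
    have hrhs : 0 ≤ A * Real.exp (-(κ * (2 / s))) := by positivity
    by_cases hx0 : thetaTest 4 v (s • siteToE x) = 0
    · rw [hx0, zero_mul, zero_mul, abs_zero]; exact hrhs
    by_cases hy0 : v (s • siteToE y) = 0
    · rw [hy0, mul_zero, zero_mul, abs_zero]; exact hrhs
    obtain ⟨hgap, -⟩ := two_mul_timeGap_le_of_charged hs.le hvδ hx0 hy0
    have hpos : (0 : ℝ) < (y 0 : ℝ) - (x 0 : ℝ) := by nlinarith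
    have hposZ : 0 < y 0 - x 0 := by exact_mod_cast hpos
    set n : ℕ := (y 0 - x 0).toNat with hn
    have hnZ : (n : ℤ) = y 0 - x 0 := Int.toNat_of_nonneg hposZ.le
    have hnR : (n : ℝ) = (y 0 : ℝ) - (x 0 : ℝ) := by exact_mod_cast hnZ
    have hxN := (mem_box.1 hx) 0
    have hyN := (mem_box.1 hy) 0
    have hnL : n ≤ L := by omega
    have hcov := hcl β hβ L x y n hnZ hnL
    have hdec : Real.exp (-(Real.log 2 / 6 * n)) ≤ Real.exp (-(κ * (2 / s))) := by
      rw [Real.exp_le_exp, neg_le_neg_iff, hκ]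
      have h1 : 2 / s * δ ≤ (n : ℝ) := by
        rw [hnR, div_mul_eq_mul_div, div_le_iff₀ hs]; linarith
      have h2 : Real.log 2 / 6 * δ * (2 / s) = Real.log 2 / 6 * (2 / s * δ) := by ring
      rw [h2]
      exact mul_le_mul_of_nonneg_left h1 (by positivity)
    rw [abs_mul, abs_mul, hA, mul_assoc (M * M)]
    refine mul_le_mul (mul_le_mul (hMθ _) (hMv _) (abs_nonneg _) hM0)
      (hcov.trans (mul_le_mul_of_nonneg_left hdec hK0)) (abs_nonneg _) (by positivity)
  -- sum over the `(2N+1)⁸` pairs and close with the envelope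
  have hcard : ((box 4 N).card : ℝ) = (((2 * N + 1) ^ 4 : ℕ) : ℝ) := by rw [card_box]
  rw [Q2_eq_sum_box r hNL β s (thetaTest 4 v) v hvf hvg]
  calc |∑ x ∈ box 4 N, ∑ y ∈ box 4 N, thetaTest 4 v (s • siteToE x) * v (s • siteToE y) *
          (torusE G r β L (fun U => dens G r x U * dens G r y U) -
            torusE G r β L (dens G r x) * torusE G r β L (dens G r y))|
      ≤ ∑ x ∈ box 4 N, |∑ y ∈ box 4 N, thetaTest 4 v (s • siteToE x) * v (s • siteToE y) *
          (torusE G r β L (fun U => dens G r x U * dens G r y U) -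
            torusE G r β L (dens G r x) * torusE G r β L (dens G r y))| :=
        Finset.abs_sum_le_sum_abs _ _
    _ ≤ ∑ x ∈ box 4 N, ∑ y ∈ box 4 N, A * Real.exp (-(κ * (2 / s))) :=
        Finset.sum_le_sum fun x hx => (Finset.abs_sum_le_sum_abs _ _).trans
          (Finset.sum_le_sum fun y hy => hterm x hx y hy)
    _ = (((2 * N + 1) ^ 4 : ℕ) : ℝ) * ((((2 * N + 1) ^ 4 : ℕ) : ℝ) *
          (A * Real.exp (-(κ * (2 / s))))) := by
        rw [Finset.sum_const, Finset.sum_const, nsmul_eq_mul, nsmul_eq_mul, hcard]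
    _ ≤ η := noFloors_envelope hA0 hκ0 hs hs_one hR0 hη hNle hsη

/-- **No two-point floors at strong coupling** — the `S`-side pattern refuted on the witness
window.  For `|β| ≤ β₀`: for every compactly supported positive-time Schwartz `v`, every
`ε > 0`, every `Λ₅` and every `s₁ > 0` there are a unit `0 < s ≤ s₁` and a torus with
`Λ₅ ≤ s·L` on which `Q2_{β,L,s}(θv, v) < ε`.  Contrast `LowerBounds` (i) of `BalabanLadder.NT`
(`ε ≤ Q2` on ALL large tori along units `a β → 0`): such floors cannot come from the
strong-coupling window. -/
theorem no_twoPointFloor_strongCoupling :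
    ∃ β₀ : ℝ, 0 < β₀ ∧ ∀ β : ℝ, |β| ≤ β₀ →
      ∀ v : 𝓢(EuclideanSpace ℝ (Fin 4), ℝ),
        tsupport (v : EuclideanSpace ℝ (Fin 4) → ℝ) ⊆ {y | 0 < y 0} →
        HasCompactSupport (v : EuclideanSpace ℝ (Fin 4) → ℝ) →
        ∀ ε : ℝ, 0 < ε → ∀ Λ₅ s₁ : ℝ, 0 < s₁ →
          ∃ s : ℝ, 0 < s ∧ s ≤ s₁ ∧ ∃ L : ℕ, Λ₅ ≤ s * L ∧
            Q2 G r β L s (thetaTest 4 v) v < ε := by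
  obtain ⟨β₀, hβ₀, h⟩ := Q2_theta_abs_le_strongCoupling r
  refine ⟨β₀, hβ₀, fun β hβ v hv hvc ε hε Λ₅ s₁ hs₁ => ?_⟩
  obtain ⟨s₂, hs₂, Λ, hΛ⟩ := h v hv hvc (ε / 2) (half_pos hε)
  set s : ℝ := min s₁ s₂ with hs
  have hs0 : 0 < s := lt_min hs₁ hs₂
  refine ⟨s, hs0, min_le_left _ _, ⌈max Λ Λ₅ / s⌉₊, ?_, ?_⟩
  · have h1 : max Λ Λ₅ / s ≤ (⌈max Λ Λ₅ / s⌉₊ : ℝ) := Nat.le_ceil _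
    rw [div_le_iff₀ hs0] at h1
    linarith [le_max_right Λ Λ₅]
  · have h1 : max Λ Λ₅ / s ≤ (⌈max Λ Λ₅ / s⌉₊ : ℝ) := Nat.le_ceil _
    rw [div_le_iff₀ hs0] at h1
    have hL : Λ ≤ s * ⌈max Λ Λ₅ / s⌉₊ := by linarith [le_max_left Λ Λ₅]
    have h2 := hΛ β hβ s hs0 (min_le_right _ _) _ hL
    exact (le_abs_self _).trans_lt (h2.trans_lt (half_lt_self hε))

end NoFloors

/-- **The `S`-side analogue refuted on the witness window, in the binder shape of the spine**
(every compact `G` with its Borel σ-algebra, any lattice representation): at each strong coupling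
`|β| ≤ β₀(r)` no positive-time compactly supported witness has a two-point reflection floor that
survives refinement of the unit on large tori.  Together with
`finiteSizeInsensitivity_strongCoupling` (the crux's clauses HOLD there) this separates
`FiniteSizeInsensitivity` from `SomeTorusFloors` / `NT`; it asserts nothing about `β → ∞`. -/
theorem no_twoPointFloor_strongCoupling_borel :
    ∀ (G : Type) [Group G] [TopologicalSpace G] [IsTopologicalGroup G] [CompactSpace G],
      letI : MeasurableSpace G := borel G
      haveI : BorelSpace G := ⟨rfl⟩
      ∀ r : LatticeRep G, ∃ β₀ : ℝ, 0 < β₀ ∧ ∀ β : ℝ, |β| ≤ β₀ →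
        ∀ v : 𝓢(EuclideanSpace ℝ (Fin 4), ℝ),
          tsupport (v : EuclideanSpace ℝ (Fin 4) → ℝ) ⊆ {y | 0 < y 0} →
          HasCompactSupport (v : EuclideanSpace ℝ (Fin 4) → ℝ) →
          ∀ ε : ℝ, 0 < ε → ∀ Λ₅ s₁ : ℝ, 0 < s₁ →
            ∃ s : ℝ, 0 < s ∧ s ≤ s₁ ∧ ∃ L : ℕ, Λ₅ ≤ s * L ∧
              Q2 G r β L s (thetaTest 4 v) v < ε := by
  intro G _ _ _ _
  letI : MeasurableSpace G := borel G
  haveI : BorelSpace G := ⟨rfl⟩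
  intro r
  exact no_twoPointFloor_strongCoupling r

end Summit.QuantumFields.YangMills.Cruxes.FiniteSizeInsensitivity.Rung

end
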